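import Mathlib
import HarnessLib
import Literature.Barriers.PneNP.SubmodularMeasures
import Literature.Computability.Complexity.SliceFunctions
import Literature.Computability.Complexity.KWProtocol
import Literature.Computability.Complexity.ThresholdMonotoneKWDepth
import Literature.Computability.Complexity.ThresholdMonotoneKWDepthProofs
import Summits.PneNP.PneNP.Theses.KrwChromaticSteering

/-!
# Crux `StrongComposition` (stmt-PneNP-18538) — FILE H: the SLICE CAP for monotone submodular
complexity measures (the measure door is shut in both worlds)

Planner workfile (cell `pnp-ideate`, seat p5, generation 11, lens «embed» at crux level).
Kernel-checked, `sorry`-free.  Route `KrwChromaticSteering` (crux C1 = `StrongComposition`).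

**What this file is NOT.** It proves nothing about the crux, the layered doors of
`LayeredKRW.lean` (FILE D) or `P ≠ NP`.  It is a CALIBRATION (a no-go theorem for one technique
class on the doors), in the sense of `Literature/Barriers/PneNP/SubmodularMeasures.lean`.

**What it IS.**  The card `Ideas/slice-semimonotone.md` embeds the crux into MONOTONE
Karchmer–Wigderson complexity of SLICE functions on Hamming layers (FILE D) and argues
("why easier (b)") that the monotone world has lower-bound engines the standard world lacks.
The strongest such engine is ALGEBRAIC: Razborov's rank measure [Razborov1990] — the quantity
that the lifting theorems of Robere–Pitassi–Rossman–Cook (2016), Pitassi–Robere (2018) and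
de Rezende–Meir–Nordström–Pitassi–Robere–Vinyals (2020) actually bound, and the engine of the
semi-monotone composition theorem of [dRMNPR20, arXiv:2007.02740: §2.5 "The Razborov rank
measure", §2.7.2, and the semi-monotone composition theorem].  By
[Razborov1992, Thm. 1 (monotone case), p. 80 of the LMS volume] every rank measure is a
**submodular complexity measure on the monotone functions `F_n^mon`**: a nonnegative `μ` with
`μ(xᵢ) ≤ 1` and `μ(f ∧ g) + μ(f ∨ g) ≤ μ f + μ g` for MONOTONE `f, g` ([Razborov1992, §2, p. 79]:
"satisfies the first condition in (1) and satisfies (4) whenever `f, g ∈ F_n^mon`").  On all of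
`F_n` such measures are `≤ 4(n+1)` ([Razborov1992, Thm. 2]; in tree:
`Literature.Barriers.PneNP.IsSubmodularMeasure.apply_le`), while on `F_n^mon` they reach
`n^{Ω(log n)}` [Razborov1990].  THIS FILE: on `k`-slice functions (`1 ≤ k ≤ n-1`) every
submodular measure on `F_n^mon` is POLYNOMIALLY CAPPED,

  `μ f ≤ 4 (n+1) · (1 + 3 · 2 ^ (18 (⌊log₂ n⌋ + 1))) ≤ 16 · (2n) ^ 19`     (`sliceCap`, `sliceCap'`),

so a rank-measure / lifting / any-submodular-potential argument certifies monotone KW depth at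
most `19 ⌊log₂ n⌋ + 41` for a slice function (`certifiedDepth_le`) — it can never deliver the
`ω(log n)` layer-depth gains the layered doors ask for.  The measure door of the card is thereby
closed in BOTH worlds: standard world by Razborov's Theorem 2, layered monotone world here.

## The mechanism (Berkowitz's slice trick, lifted from circuits to measures)
`slicify k f := (f ∧ Th_k) ∨ Th_{k+1}` is a LATTICE HOMOMORPHISM `F_n → F_n^mon`
(`slicify_inf`, `slicify_sup`, `monotone_slicify`) fixing the `k`-slice functions
(`slicify_eq_self`).  Hence `ν := μ ∘ slicify k`, rescaled by the largest value `B` on the `2n`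
slicified literals, is a submodular measure on ALL of `F_n`, and Razborov's Theorem 2 caps it:
THEOREM A `apply_le_of_isSliceFunction` (`μ f ≤ 4(n+1)·B`).  The slicified literals are
`(xᵢ ∧ Th_k) ∨ Th_{k+1}` and `(Th_{k+1}(x[i ↦ 1]) ∧ Th_k) ∨ Th_{k+1}` (`slicify_compl_proj`; the
second is Berkowitz's pseudo-complement in threshold clothing), so `B ≤ 1 + 3τ` with `τ` the
largest value of `μ` on the thresholds involved (`apply_slicify_proj_le`,
`apply_slicify_compl_proj_le`).  THEOREM B: `μ h ≤ #leaves(P) ≤ 2 ^ depth P` for every protocol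
`P` solving the MONOTONE KW game of a non-constant `h` (`apply_le_leafCount_of_solvesMono`, the
measure form of Karchmer–Wigderson's easy direction), and Valiant's `O(log n)`-depth monotone
protocols for thresholds (in tree, kernel-checked with constant 18:
`KWTree.exists_solvesMono_thresholdFn`) give `τ ≤ 2 ^ (18(⌊log₂ n⌋+1))` (`apply_thresholdFn_le`,
`apply_bump_le`).  The edge slices `k = 0` (`f ∈ {⊤, OR}`) and `k = n` (`f ∈ {⊥, AND}`) are
genuinely excluded: `μ ⊤`, `μ ⊥` are unconstrained for a submodular measure on `F_n^mon`
(`exists_measure_top_large`).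

§ RANK (v2) makes the rank-method corollary formal rather than cited: Razborov's rank measure
`μ_A(f) = rk(A_{R_f}) / max_i rk(A_{R_{0i}})` (`rankMeasure`; `rectRank` = dimension of the column
span of the rectangle submatrix, `= Matrix.rank` by `rectRank_eq_rank`) IS a submodular measure on
`F_n^mon` — [Razborov1992, Thm. 1, monotone case] kernel-checked as
`isMonotoneSubmodularMeasure_rankMeasure` via Razborov's linear matroid and the identity
`ρ((U ∪ V) ∩ f⁻¹(1)) = rk(A_{R_f}) + |U ∩ f⁻¹(1)|` (`rho_eq`, rank–nullity for the projection onto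
the rows `U ∩ f⁻¹(0)`) — hence THE RANK METHOD ON SLICES (`rank_rectangle_le_of_isSliceFunction`):
for a `k`-slice `f` (`1 ≤ k ≤ n-1`), any `U ⊆ f⁻¹(0)`-indexed rows / `V ⊆ f⁻¹(1)`-indexed columns
(indeed any finite `U, V`), any field, any `A`: `rk(A_{R_f}) ≤ 16 (2n)^19 · max(1, max_i rk(A_{R_{0i}}))`.

§ LAYER (v3) says it in the language of FILE D's layered games (`SolvesLayeredMono`, verbatim): a
submodular measure on `F_n^mon` certifies for a layer-`l`-correct monotone protocol `Q` only
`#leaves(Q) ≥ μ h` for SOME monotone `h` agreeing with `f` on the layer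
(`exists_separator_of_solvesLayeredMono`), and for every `f` and every proper layer that infimum is
`≤ μ (slicify l f) ≤ 16 (2n)^19` (`layered_certificate_le`, `layered_certifiedDepth_le`: certified
layered depth `≤ 19 ⌊log₂ n⌋ + 41`).

Presearch (corpus fts+vec and galaxy, 2026-08-28): the cap is not stated in [Razborov1992]
(no occurrence of "slice"), [Jukna2012, §6.10 Thm 6.40, §10.1] or [dRMNPR20] (which names slice
lower bounds as a GOAL of monotone KRW, arXiv p. 5, and records only that the rank measure fails
for NON-monotone KW relations, open-problems section, arXiv p. 33); nearest print: Berkowitz 1982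
/ [Jukna2012, Thm 10.1]
(negations are powerless on slices, for CIRCUITS) and [Razborov1992, Thm 2].  Honest grade:
a folklore-strength corollary, apparently unrecorded; its use here is the calibration above.
-/

set_option linter.dupNamespace false
set_option autoImplicit false

namespace Summit.PneNP.PneNP.Cruxes.StrongComposition.SubmodularSliceCap

open Finset
open Literature.Barriers.PneNP (proj proj_apply IsSubmodularMeasure)
open Literature.Computability.Complexity

variable {n : ℕ}

/-! ### Pointwise Boolean lattice bookkeeping -/

theorem inf_apply_eq (f g : (Fin n → Bool) → Bool) (x : Fin n → Bool) :
    (f ⊓ g) x = (f x && g x) := rfl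

theorem sup_apply_eq (f g : (Fin n → Bool) → Bool) (x : Fin n → Bool) :
    (f ⊔ g) x = (f x || g x) := rfl

theorem compl_apply_eq (f : (Fin n → Bool) → Bool) (x : Fin n → Bool) :
    fᶜ x = !(f x) := rfl

/-- A Boolean-valued map is monotone iff `true` values propagate upwards. [folklore] -/
theorem monotone_iff_forall_true {α : Type*} [Preorder α] (f : α → Bool) :
    Monotone f ↔ ∀ x y, x ≤ y → f x = true → f y = true := by
  constructor
  · intro hf x y hxy hx
    exact Bool.le_iff_imp.1 (hf hxy) hx
  · intro h x y hxy
    exact Bool.le_iff_imp.2 (h x y hxy)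

theorem le_iff_forall_true (x y : Fin n → Bool) : x ≤ y ↔ ∀ i, x i = true → y i = true := by
  simp only [Pi.le_def, Bool.le_iff_imp]

/-! ### Hamming weight under the pointwise order -/

theorem hammingWeight_mono {x y : Fin n → Bool} (hxy : x ≤ y) :
    hammingWeight x ≤ hammingWeight y := by
  unfold hammingWeight
  exact card_le_card fun i hi => mem_filter.2 ⟨mem_univ _,
    (le_iff_forall_true x y).1 hxy i (mem_filter.1 hi).2⟩

theorem eq_of_le_of_hammingWeight_le {x y : Fin n → Bool} (hxy : x ≤ y)
    (hw : hammingWeight y ≤ hammingWeight x) : x = y := by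
  have hsub : (univ.filter fun i => x i = true) ⊆ univ.filter fun i => y i = true :=
    fun i hi => mem_filter.2 ⟨mem_univ _, (le_iff_forall_true x y).1 hxy i (mem_filter.1 hi).2⟩
  have heq := eq_of_subset_of_card_le hsub hw
  funext i
  have hi : x i = true ↔ y i = true := by
    constructor
    · exact (le_iff_forall_true x y).1 hxy i
    · intro hy
      have : i ∈ univ.filter fun i => y i = true := mem_filter.2 ⟨mem_univ _, hy⟩
      rw [← heq] at this
      exact (mem_filter.1 this).2
  cases hx : x i <;> cases hy : y i <;> simp_all

theorem hammingWeight_top : hammingWeight (fun _ : Fin n => true) = n := by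
  simp [hammingWeight]

theorem hammingWeight_bot : hammingWeight (fun _ : Fin n => false) = 0 := by
  simp [hammingWeight]

theorem hammingWeight_update_true (x : Fin n → Bool) (i : Fin n) :
    hammingWeight (Function.update x i true) =
      if x i = true then hammingWeight x else hammingWeight x + 1 := by
  classical
  by_cases h : x i = true
  · rw [if_pos h, ← h, Function.update_eq_self]
  · rw [if_neg h]
    unfold hammingWeight
    have hset : (univ.filter fun j => Function.update x i true j = true) =
        insert i (univ.filter fun j => x j = true) := by
      ext j
      by_cases hj : j = i
      · subst hj; simp
      · simp [hj]
    rw [hset, card_insert_of_notMem]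
    simpa using h

/-! ### Thresholds and the slicification homomorphism -/

theorem monotone_thresholdFn (n k : ℕ) : Monotone (thresholdFn n k) := by
  rw [monotone_iff_forall_true]
  intro x y hxy hx
  rw [thresholdFn_eq_true_iff] at hx ⊢
  exact hx.trans (hammingWeight_mono hxy)

theorem monotone_proj (i : Fin n) : Monotone (proj i) := fun x y hxy => by
  simpa [proj] using hxy i

/-- Berkowitz's slicification `(f ∧ Th_k) ∨ Th_{k+1}` [cite: Jukna2012, §10.1.1 (PDF p. 299)]. -/
def slicify (k : ℕ) (f : (Fin n → Bool) → Bool) : (Fin n → Bool) → Bool :=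
  (f ⊓ thresholdFn n k) ⊔ thresholdFn n (k + 1)

theorem slicify_apply (k : ℕ) (f : (Fin n → Bool) → Bool) (x : Fin n → Bool) :
    slicify k f x = ((f x && thresholdFn n k x) || thresholdFn n (k + 1) x) := rfl

/-- `slicify k` preserves `∧`. -/
theorem slicify_inf (k : ℕ) (f g : (Fin n → Bool) → Bool) :
    slicify k (f ⊓ g) = slicify k f ⊓ slicify k g := by
  funext x
  rw [inf_apply_eq, slicify_apply, slicify_apply, slicify_apply, inf_apply_eq]
  cases f x <;> cases g x <;> cases thresholdFn n k x <;> cases thresholdFn n (k + 1) x <;> rfl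

/-- `slicify k` preserves `∨`. -/
theorem slicify_sup (k : ℕ) (f g : (Fin n → Bool) → Bool) :
    slicify k (f ⊔ g) = slicify k f ⊔ slicify k g := by
  funext x
  rw [sup_apply_eq, slicify_apply, slicify_apply, slicify_apply, sup_apply_eq]
  cases f x <;> cases g x <;> cases thresholdFn n k x <;> cases thresholdFn n (k + 1) x <;> rfl

/-- `slicify k f` is a `k`-slice function. -/
theorem isSliceFunction_slicify (k : ℕ) (f : (Fin n → Bool) → Bool) :
    IsSliceFunction k (slicify k f) := by
  refine ⟨fun x hx => ?_, fun x hx => ?_⟩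
  · have h1 : thresholdFn n k x = false := (thresholdFn_eq_false_iff x).2 hx
    have h2 : thresholdFn n (k + 1) x = false := (thresholdFn_eq_false_iff x).2 (by omega)
    rw [slicify_apply, h1, h2]; cases f x <;> rfl
  · have h2 : thresholdFn n (k + 1) x = true := (thresholdFn_eq_true_iff x).2 hx
    rw [slicify_apply, h2]; simp

/-- `slicify k` fixes the `k`-slice functions. -/
theorem slicify_eq_self {k : ℕ} {f : (Fin n → Bool) → Bool} (hf : IsSliceFunction k f) :
    slicify k f = f := by
  funext x
  rw [slicify_apply]
  rcases lt_trichotomy (hammingWeight x) k with hlt | heq | hgt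
  · rw [hf.1 x hlt, (thresholdFn_eq_false_iff x).2 (by omega : hammingWeight x < k + 1)]; rfl
  · rw [(thresholdFn_eq_true_iff x).2 heq.ge,
      (thresholdFn_eq_false_iff x).2 (by omega : hammingWeight x < k + 1)]
    cases f x <;> rfl
  · rw [hf.2 x hgt, (thresholdFn_eq_true_iff x).2 (by omega : k + 1 ≤ hammingWeight x)]; simp

/-- `slicify k f` is monotone for EVERY `f`: the homomorphism lands in `F_n^mon`. -/
theorem monotone_slicify (k : ℕ) (f : (Fin n → Bool) → Bool) : Monotone (slicify k f) := by
  rw [monotone_iff_forall_true]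
  intro x y hxy hx
  rw [slicify_apply] at hx ⊢
  have hw := hammingWeight_mono hxy
  by_cases hy1 : thresholdFn n (k + 1) y = true
  · rw [hy1]; simp
  · -- `|y| ≤ k`, hence `|x| ≤ k`; `x` is accepted, so `|x| = k = |y|` and `x = y`
    have hyk : hammingWeight y < k + 1 := (thresholdFn_eq_false_iff y).1 (by simpa using hy1)
    have hx1 : thresholdFn n (k + 1) x = false :=
      (thresholdFn_eq_false_iff x).2 (lt_of_le_of_lt hw hyk)
    rw [hx1, Bool.or_false, Bool.and_eq_true, thresholdFn_eq_true_iff] at hx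
    have hxy' : x = y := eq_of_le_of_hammingWeight_le hxy (by omega)
    subst hxy'
    rw [hx.1, (thresholdFn_eq_true_iff x).2 hx.2]; rfl

/-! ### The slicified literals -/

/-- `x ↦ Th_{k+1}(x with xᵢ := 1)`: on the `k`-th slice this is `¬xᵢ` (Berkowitz's
pseudo-complement, [cite: Jukna2012, §10.1.1 eq. (10.1) (PDF p. 300)]), and it is monotone. -/
def bump (i : Fin n) (k : ℕ) : (Fin n → Bool) → Bool :=
  fun x => thresholdFn n (k + 1) (Function.update x i true)

theorem monotone_bump (i : Fin n) (k : ℕ) : Monotone (bump i k) := by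
  intro x y hxy
  apply monotone_thresholdFn n (k + 1)
  intro j
  by_cases hj : j = i
  · subst hj; simp
  · simpa [Function.update_of_ne hj] using hxy j

theorem slicify_proj (k : ℕ) (i : Fin n) :
    slicify k (proj i) = (proj i ⊓ thresholdFn n k) ⊔ thresholdFn n (k + 1) := rfl

/-- The slicified NEGATIVE literal is a monotone lattice expression in thresholds. -/
theorem slicify_compl_proj (k : ℕ) (i : Fin n) :
    slicify k (proj i)ᶜ = (bump i k ⊓ thresholdFn n k) ⊔ thresholdFn n (k + 1) := by
  funext x
  rw [slicify_apply, sup_apply_eq, inf_apply_eq, compl_apply_eq, proj_apply]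
  by_cases h1 : thresholdFn n (k + 1) x = true
  · rw [h1]; simp
  · have h1' : thresholdFn n (k + 1) x = false := by simpa using h1
    rw [h1']
    by_cases h0 : thresholdFn n k x = true
    · rw [h0]
      have hk : hammingWeight x = k := by
        have := (thresholdFn_eq_true_iff x).1 h0
        have := (thresholdFn_eq_false_iff x).1 h1'
        omega
      have hb : bump i k x = !x i := by
        unfold bump thresholdFn
        rw [hammingWeight_update_true]
        cases hxi : x i <;> simp [hk]
      rw [hb]
    · have h0' : thresholdFn n k x = false := by simpa using h0
      rw [h0']; simp

/-! ### Submodular complexity measures on the monotone functions (Razborov 1992, §2) -/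

/-- **Submodular complexity measure on `F_n^mon`** [cite: Razborov1992, §2 (p. 79): "satisfies
the first condition in (1) and satisfies (4) whenever `f, g ∈ F_n^mon`"]: nonnegative on monotone
functions, `μ(xᵢ) ≤ 1`, and submodular on MONOTONE pairs.  (Values on non-monotone arguments
are irrelevant junk.)  Razborov's monotone rank measures are examples
[cite: Razborov1992, Thm. 1 (monotone case), p. 80]. -/
def IsMonotoneSubmodularMeasure (μ : ((Fin n → Bool) → Bool) → ℝ) : Prop :=
  (∀ f, Monotone f → 0 ≤ μ f) ∧ (∀ i : Fin n, μ (proj i) ≤ 1) ∧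
    ∀ f g, Monotone f → Monotone g → μ (f ⊓ g) + μ (f ⊔ g) ≤ μ f + μ g

namespace IsMonotoneSubmodularMeasure

variable {μ : ((Fin n → Bool) → Bool) → ℝ}

/-- Every submodular measure on `F_n` restricts to one on `F_n^mon`. -/
theorem of_isSubmodularMeasure (hμ : IsSubmodularMeasure μ) : IsMonotoneSubmodularMeasure μ :=
  ⟨fun f _ => hμ.1 f, fun i => (hμ.2.1 i).1, fun f g _ _ => hμ.2.2 f g⟩

theorem sup_le (hμ : IsMonotoneSubmodularMeasure μ) {f g : (Fin n → Bool) → Bool}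
    (hf : Monotone f) (hg : Monotone g) : μ (f ⊔ g) ≤ μ f + μ g := by
  have := hμ.2.2 f g hf hg; have := hμ.1 (f ⊓ g) (hf.inf hg); linarith

theorem inf_le (hμ : IsMonotoneSubmodularMeasure μ) {f g : (Fin n → Bool) → Bool}
    (hf : Monotone f) (hg : Monotone g) : μ (f ⊓ g) ≤ μ f + μ g := by
  have := hμ.2.2 f g hf hg; have := hμ.1 (f ⊔ g) (hf.sup hg); linarith

/-! ### THEOREM A — the abstract slice cap -/

/-- **THEOREM A (slice cap, abstract form).** If `μ` is a submodular measure on `F_n^mon`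
(`n ≥ 1`) and `B > 0` bounds `μ` on the `2n` slicified literals of the `k`-th slice, then
`μ f ≤ 4(n+1)·B` for every `k`-slice function `f`.  Proof: `μ ∘ slicify k / B` is a submodular
measure on ALL of `F_n` (slicify is a lattice homomorphism into `F_n^mon`), so Razborov's
Theorem 2 (`IsSubmodularMeasure.apply_le`) applies, and `slicify k f = f`. -/
theorem apply_le_of_isSliceFunction (hμ : IsMonotoneSubmodularMeasure μ) (hn : 0 < n)
    {k : ℕ} {B : ℝ} (hB : 0 < B)
    (hlit : ∀ i : Fin n, μ (slicify k (proj i)) ≤ B ∧ μ (slicify k (proj i)ᶜ) ≤ B)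
    {f : (Fin n → Bool) → Bool} (hf : IsSliceFunction k f) :
    μ f ≤ 4 * (n + 1) * B := by
  set ν : ((Fin n → Bool) → Bool) → ℝ := fun g => μ (slicify k g) / B with hν_def
  have hν : IsSubmodularMeasure ν := by
    refine ⟨fun g => div_nonneg (hμ.1 _ (monotone_slicify k g)) hB.le,
      fun i => ⟨(div_le_one hB).2 (hlit i).1, (div_le_one hB).2 (hlit i).2⟩, fun g h => ?_⟩
    simp only [hν_def]
    rw [slicify_inf, slicify_sup, ← add_div, ← add_div]
    exact div_le_div_of_nonneg_right
      (hμ.2.2 _ _ (monotone_slicify k g) (monotone_slicify k h)) hB.le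
  have hcap := hν.apply_le hn f
  simp only [hν_def, slicify_eq_self hf] at hcap
  rwa [div_le_iff₀ hB] at hcap

/-- The slicified positive literal costs at most `1 + μ Th_k + μ Th_{k+1}`. -/
theorem apply_slicify_proj_le (hμ : IsMonotoneSubmodularMeasure μ) (k : ℕ) (i : Fin n) :
    μ (slicify k (proj i)) ≤ 1 + μ (thresholdFn n k) + μ (thresholdFn n (k + 1)) := by
  rw [slicify_proj]
  have h1 := hμ.sup_le ((monotone_proj i).inf (monotone_thresholdFn n k))
    (monotone_thresholdFn n (k + 1))
  have h2 := hμ.inf_le (monotone_proj i) (monotone_thresholdFn n k)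
  have h3 := hμ.2.1 i
  linarith

/-- The slicified negative literal costs at most `μ bump + μ Th_k + μ Th_{k+1}`. -/
theorem apply_slicify_compl_proj_le (hμ : IsMonotoneSubmodularMeasure μ) (k : ℕ) (i : Fin n) :
    μ (slicify k (proj i)ᶜ) ≤ μ (bump i k) + μ (thresholdFn n k) + μ (thresholdFn n (k + 1)) := by
  rw [slicify_compl_proj]
  have h1 := hμ.sup_le ((monotone_bump i k).inf (monotone_thresholdFn n k))
    (monotone_thresholdFn n (k + 1))
  have h2 := hμ.inf_le (monotone_bump i k) (monotone_thresholdFn n k)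
  linarith

/-! ### THEOREM B — protocols dominate measures (Karchmer–Wigderson, measure form) -/

/-- Measure form of `KWTree.exists_formula_of_rectangle`: a protocol whose outputs are monotone
KW answers on a rectangle `A × B` (both sides inhabited) yields a MONOTONE separator `φ`
(`φ = 1` on `A`, `φ = 0` on `B`) of measure at most the number of leaves.
[cite: KarchmerWigderson1990, §2 (easy direction)] [cite: Razborov1992, §1 ("obvious induction")] -/
theorem exists_separator_of_rectangle (hμ : IsMonotoneSubmodularMeasure μ) :
    ∀ (P : KWTree (Fin n)) (A B : Set (Fin n → Bool)), A.Nonempty → B.Nonempty →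
      (∀ a ∈ A, ∀ b ∈ B, a (P.run a b) = true ∧ b (P.run a b) = false) →
      ∃ φ : (Fin n → Bool) → Bool, Monotone φ ∧ (∀ a ∈ A, φ a = true) ∧
        (∀ b ∈ B, φ b = false) ∧ μ φ ≤ P.leafCount := by
  intro P
  induction P with
  | leaf i =>
    intro A B hA hB hrun
    obtain ⟨a₀, ha₀⟩ := hA
    obtain ⟨b₀, hb₀⟩ := hB
    refine ⟨proj i, monotone_proj i, fun a ha => ?_, fun b hb => ?_, ?_⟩
    · simpa using (hrun a ha b₀ hb₀).1
    · simpa using (hrun a₀ ha₀ b hb).2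
    · simpa using hμ.2.1 i
  | alice s P Q ihP ihQ =>
    intro A B hA hB hrun
    have hrun₀ : ∀ a ∈ A ∩ {a | s a = false}, ∀ b ∈ B,
        a (P.run a b) = true ∧ b (P.run a b) = false := by
      rintro a ⟨ha, (hs : s a = false)⟩ b hb
      simpa [hs] using hrun a ha b hb
    have hrun₁ : ∀ a ∈ A ∩ {a | s a = true}, ∀ b ∈ B,
        a (Q.run a b) = true ∧ b (Q.run a b) = false := by
      rintro a ⟨ha, (hs : s a = true)⟩ b hb
      simpa [hs] using hrun a ha b hb
    have hPpos : (0 : ℝ) ≤ P.leafCount := Nat.cast_nonneg _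
    have hQpos : (0 : ℝ) ≤ Q.leafCount := Nat.cast_nonneg _
    by_cases hA₀ : (A ∩ {a | s a = false}).Nonempty
    · by_cases hA₁ : (A ∩ {a | s a = true}).Nonempty
      · obtain ⟨φ₀, hm₀, hT₀, hF₀, hs₀⟩ := ihP _ _ hA₀ hB hrun₀
        obtain ⟨φ₁, hm₁, hT₁, hF₁, hs₁⟩ := ihQ _ _ hA₁ hB hrun₁
        refine ⟨φ₀ ⊔ φ₁, hm₀.sup hm₁, fun a ha => ?_, fun b hb => ?_, ?_⟩
        · rw [sup_apply_eq]
          cases hsa : s a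
          · rw [hT₀ a ⟨ha, hsa⟩]; rfl
          · rw [hT₁ a ⟨ha, hsa⟩]; simp
        · rw [sup_apply_eq, hF₀ b hb, hF₁ b hb]; rfl
        · have := hμ.sup_le hm₀ hm₁
          push_cast [KWTree.leafCount_alice]
          linarith
      · -- `A₁ = ∅`: all of `A` goes left
        have hAeq : ∀ a ∈ A, s a = false := fun a ha => by
          cases hsa : s a
          · rfl
          · exact (hA₁ ⟨a, ha, hsa⟩).elim
        obtain ⟨φ₀, hm₀, hT₀, hF₀, hs₀⟩ :=
          ihP A B hA hB fun a ha b hb => hrun₀ a ⟨ha, hAeq a ha⟩ b hb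
        refine ⟨φ₀, hm₀, hT₀, hF₀, ?_⟩
        push_cast [KWTree.leafCount_alice]
        linarith
    · have hAeq : ∀ a ∈ A, s a = true := fun a ha => by
        cases hsa : s a
        · exact (hA₀ ⟨a, ha, hsa⟩).elim
        · rfl
      by_cases hA₁ : (A ∩ {a | s a = true}).Nonempty
      · obtain ⟨φ₁, hm₁, hT₁, hF₁, hs₁⟩ :=
          ihQ A B hA hB fun a ha b hb => hrun₁ a ⟨ha, hAeq a ha⟩ b hb
        refine ⟨φ₁, hm₁, hT₁, hF₁, ?_⟩
        push_cast [KWTree.leafCount_alice]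
        linarith
      · obtain ⟨a, ha⟩ := hA
        exact (hA₁ ⟨a, ha, hAeq a ha⟩).elim
  | bob s P Q ihP ihQ =>
    intro A B hA hB hrun
    have hrun₀ : ∀ a ∈ A, ∀ b ∈ B ∩ {b | s b = false},
        a (P.run a b) = true ∧ b (P.run a b) = false := by
      rintro a ha b ⟨hb, (hs : s b = false)⟩
      simpa [hs] using hrun a ha b hb
    have hrun₁ : ∀ a ∈ A, ∀ b ∈ B ∩ {b | s b = true},
        a (Q.run a b) = true ∧ b (Q.run a b) = false := by
      rintro a ha b ⟨hb, (hs : s b = true)⟩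
      simpa [hs] using hrun a ha b hb
    have hPpos : (0 : ℝ) ≤ P.leafCount := Nat.cast_nonneg _
    have hQpos : (0 : ℝ) ≤ Q.leafCount := Nat.cast_nonneg _
    by_cases hB₀ : (B ∩ {b | s b = false}).Nonempty
    · by_cases hB₁ : (B ∩ {b | s b = true}).Nonempty
      · obtain ⟨φ₀, hm₀, hT₀, hF₀, hs₀⟩ := ihP _ _ hA hB₀ hrun₀
        obtain ⟨φ₁, hm₁, hT₁, hF₁, hs₁⟩ := ihQ _ _ hA hB₁ hrun₁
        refine ⟨φ₀ ⊓ φ₁, hm₀.inf hm₁, fun a ha => ?_, fun b hb => ?_, ?_⟩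
        · rw [inf_apply_eq, hT₀ a ha, hT₁ a ha]; rfl
        · rw [inf_apply_eq]
          cases hsb : s b
          · rw [hF₀ b ⟨hb, hsb⟩]; rfl
          · rw [hF₁ b ⟨hb, hsb⟩]; simp
        · have := hμ.inf_le hm₀ hm₁
          push_cast [KWTree.leafCount_bob]
          linarith
      · have hBeq : ∀ b ∈ B, s b = false := fun b hb => by
          cases hsb : s b
          · rfl
          · exact (hB₁ ⟨b, hb, hsb⟩).elim
        obtain ⟨φ₀, hm₀, hT₀, hF₀, hs₀⟩ :=
          ihP A B hA hB fun a ha b hb => hrun₀ a ha b ⟨hb, hBeq b hb⟩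
        refine ⟨φ₀, hm₀, hT₀, hF₀, ?_⟩
        push_cast [KWTree.leafCount_bob]
        linarith
    · have hBeq : ∀ b ∈ B, s b = true := fun b hb => by
        cases hsb : s b
        · exact (hB₀ ⟨b, hb, hsb⟩).elim
        · rfl
      by_cases hB₁ : (B ∩ {b | s b = true}).Nonempty
      · obtain ⟨φ₁, hm₁, hT₁, hF₁, hs₁⟩ :=
          ihQ A B hA hB fun a ha b hb => hrun₁ a ha b ⟨hb, hBeq b hb⟩
        refine ⟨φ₁, hm₁, hT₁, hF₁, ?_⟩
        push_cast [KWTree.leafCount_bob]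
        linarith
      · obtain ⟨b, hb⟩ := hB
        exact (hB₁ ⟨b, hb, hBeq b hb⟩).elim

/-- **THEOREM B.** A submodular measure on `F_n^mon` is dominated by monotone protocols:
`μ h ≤ #leaves(P)` whenever `P` solves the monotone KW game of a non-constant `h`. -/
theorem apply_le_leafCount_of_solvesMono (hμ : IsMonotoneSubmodularMeasure μ)
    (P : KWTree (Fin n)) {h : (Fin n → Bool) → Bool} (hP : P.SolvesMono h)
    (h1 : ∃ a, h a = true) (h0 : ∃ b, h b = false) : μ h ≤ P.leafCount := by
  obtain ⟨φ, -, hT, hF, hle⟩ := hμ.exists_separator_of_rectangle P {a | h a = true}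
    {b | h b = false} h1 h0 fun a ha b hb => hP a b ha hb
  have hφ : φ = h := by
    funext x
    cases hx : h x
    · exact hF x hx
    · exact hT x hx
  rw [← hφ]; exact hle

/-- Depth form: `μ h ≤ 2 ^ depth P`. -/
theorem apply_le_two_pow_depth (hμ : IsMonotoneSubmodularMeasure μ)
    (P : KWTree (Fin n)) {h : (Fin n → Bool) → Bool} (hP : P.SolvesMono h)
    (h1 : ∃ a, h a = true) (h0 : ∃ b, h b = false) : μ h ≤ 2 ^ P.depth := by
  refine (hμ.apply_le_leafCount_of_solvesMono P hP h1 h0).trans ?_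
  exact_mod_cast P.leafCount_le_two_pow_depth

/-- Thresholds are cheap: `μ Th_k ≤ 2 ^ (18(⌊log₂ n⌋+1))` for `1 ≤ k ≤ n` (Valiant's monotone
protocol, kernel-checked in tree as `KWTree.exists_solvesMono_thresholdFn`). -/
theorem apply_thresholdFn_le (hμ : IsMonotoneSubmodularMeasure μ) {k : ℕ} (hk : 1 ≤ k)
    (hkn : k ≤ n) : μ (thresholdFn n k) ≤ 2 ^ (18 * (Nat.log 2 n + 1)) := by
  have hn : 1 ≤ n := hk.trans hkn
  obtain ⟨T, hd, hT⟩ := KWTree.exists_solvesMono_thresholdFn n k hn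
  have h1 : ∃ a, thresholdFn n k a = true :=
    ⟨fun _ => true, (thresholdFn_eq_true_iff _).2 (by rw [hammingWeight_top]; exact hkn)⟩
  have h0 : ∃ b, thresholdFn n k b = false :=
    ⟨fun _ => false, (thresholdFn_eq_false_iff _).2 (by rw [hammingWeight_bot]; exact hk)⟩
  refine (hμ.apply_le_two_pow_depth T hT h1 h0).trans ?_
  exact pow_le_pow_right₀ (by norm_num) hd

/-! ### Transporting a protocol along `x ↦ x[i ↦ 1]` -/

/-- Precompose every message function of a protocol with a map of inputs. -/
def premap {ι : Type*} (u : (ι → Bool) → (ι → Bool)) : KWTree ι → KWTree ι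
  | .leaf i => .leaf i
  | .alice s P Q => .alice (s ∘ u) (premap u P) (premap u Q)
  | .bob s P Q => .bob (s ∘ u) (premap u P) (premap u Q)

theorem run_premap {ι : Type*} (u : (ι → Bool) → (ι → Bool)) :
    ∀ (P : KWTree ι) (a b : ι → Bool), (premap u P).run a b = P.run (u a) (u b)
  | .leaf i, a, b => rfl
  | .alice s P Q, a, b => by
    simp only [premap, KWTree.run_alice, Function.comp_apply, run_premap u P, run_premap u Q]
  | .bob s P Q, a, b => by
    simp only [premap, KWTree.run_bob, Function.comp_apply, run_premap u P, run_premap u Q]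

theorem depth_premap {ι : Type*} (u : (ι → Bool) → (ι → Bool)) :
    ∀ P : KWTree ι, (premap u P).depth = P.depth
  | .leaf i => rfl
  | .alice s P Q => by simp only [premap, KWTree.depth_alice, depth_premap u P, depth_premap u Q]
  | .bob s P Q => by simp only [premap, KWTree.depth_bob, depth_premap u P, depth_premap u Q]

/-- A monotone protocol for `Th_{k+1}` transported along `x ↦ x[i ↦ 1]` solves the monotone game
of `bump i k`: the answer coordinate is never `i` (Bob's transported input has a `1` there). -/
theorem solvesMono_bump {T : KWTree (Fin n)} {k : ℕ} (hT : T.SolvesMono (thresholdFn n (k + 1)))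
    (i : Fin n) : (premap (fun x => Function.update x i true) T).SolvesMono (bump i k) := by
  intro a b ha hb
  rw [run_premap]
  obtain ⟨hja, hjb⟩ := hT _ _ ha hb
  have hji : T.run (Function.update a i true) (Function.update b i true) ≠ i := by
    intro h
    rw [h] at hjb
    simp at hjb
  rw [Function.update_of_ne hji] at hja hjb
  exact ⟨hja, hjb⟩

/-- The pseudo-complement ingredient is cheap too: `μ (bump i k) ≤ 2 ^ (18(⌊log₂ n⌋+1))` for
`1 ≤ k`, `k + 1 ≤ n`. -/
theorem apply_bump_le (hμ : IsMonotoneSubmodularMeasure μ) (i : Fin n) {k : ℕ} (hk : 1 ≤ k)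
    (hkn : k + 1 ≤ n) : μ (bump i k) ≤ 2 ^ (18 * (Nat.log 2 n + 1)) := by
  have hn : 1 ≤ n := by omega
  obtain ⟨T, hd, hT⟩ := KWTree.exists_solvesMono_thresholdFn n (k + 1) hn
  have h1 : ∃ a, bump i k a = true := by
    refine ⟨fun _ => true, (thresholdFn_eq_true_iff _).2 ?_⟩
    rw [hammingWeight_update_true, if_pos rfl, hammingWeight_top]; exact hkn
  have h0 : ∃ b, bump i k b = false := by
    refine ⟨fun _ => false, (thresholdFn_eq_false_iff _).2 ?_⟩
    rw [hammingWeight_update_true, if_neg (by simp), hammingWeight_bot]; omega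
  refine (hμ.apply_le_two_pow_depth _ (solvesMono_bump hT i) h1 h0).trans ?_
  rw [depth_premap]
  exact pow_le_pow_right₀ (by norm_num) hd

/-! ### The slice cap -/

/-- **SLICE CAP.** For every submodular complexity measure `μ` on `F_n^mon` and every `k`-slice
function `f` with `1 ≤ k ≤ n - 1`: `μ f ≤ 4(n+1)·(1 + 3·2^(18(⌊log₂ n⌋+1)))`. -/
theorem sliceCap (hμ : IsMonotoneSubmodularMeasure μ) {k : ℕ} (hk : 1 ≤ k) (hkn : k + 1 ≤ n)
    {f : (Fin n → Bool) → Bool} (hf : IsSliceFunction k f) :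
    μ f ≤ 4 * (n + 1) * (1 + 3 * 2 ^ (18 * (Nat.log 2 n + 1))) := by
  set D : ℝ := 2 ^ (18 * (Nat.log 2 n + 1)) with hD
  have hD0 : 0 ≤ D := by positivity
  have hTk := hμ.apply_thresholdFn_le hk (by omega : k ≤ n)
  have hTk1 := hμ.apply_thresholdFn_le (by omega : 1 ≤ k + 1) hkn
  refine hμ.apply_le_of_isSliceFunction (by omega) (by positivity) (fun i => ⟨?_, ?_⟩) hf
  · have := hμ.apply_slicify_proj_le k i
    linarith
  · have := hμ.apply_slicify_compl_proj_le k i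
    have := hμ.apply_bump_le i hk hkn
    linarith

/-- `2 ^ (18(⌊log₂ n⌋+1)) ≤ (2n)^18`. -/
theorem two_pow_log_le (hn : 1 ≤ n) : (2 : ℝ) ^ (18 * (Nat.log 2 n + 1)) ≤ (2 * n) ^ 18 := by
  have h : 2 ^ (Nat.log 2 n + 1) ≤ 2 * n := by
    rw [pow_succ]
    have := Nat.pow_log_le_self 2 (by omega : n ≠ 0)
    linarith
  have h' : (2 : ℝ) ^ (Nat.log 2 n + 1) ≤ 2 * n := by exact_mod_cast h
  calc (2 : ℝ) ^ (18 * (Nat.log 2 n + 1)) = ((2 : ℝ) ^ (Nat.log 2 n + 1)) ^ 18 := by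
        rw [← pow_mul, mul_comm]
    _ ≤ (2 * n) ^ 18 := pow_le_pow_left₀ (by positivity) h' 18

/-- **SLICE CAP, polynomial form**: `μ f ≤ 16 · (2n)^19` on the proper slices. -/
theorem sliceCap' (hμ : IsMonotoneSubmodularMeasure μ) {k : ℕ} (hk : 1 ≤ k) (hkn : k + 1 ≤ n)
    {f : (Fin n → Bool) → Bool} (hf : IsSliceFunction k f) :
    μ f ≤ 16 * (2 * n) ^ 19 := by
  have hn : 1 ≤ n := by omega
  have h := hμ.sliceCap hk hkn hf
  have hD := two_pow_log_le hn
  have hn' : (1 : ℝ) ≤ n := by exact_mod_cast hn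
  have hP : (0 : ℝ) ≤ (2 * n) ^ 18 := by positivity
  calc μ f ≤ 4 * (n + 1) * (1 + 3 * 2 ^ (18 * (Nat.log 2 n + 1))) := h
    _ ≤ 4 * (2 * n) * (4 * (2 * n) ^ 18) := by
        apply mul_le_mul
        · linarith
        · have : (1 : ℝ) ≤ (2 * n) ^ 18 := one_le_pow₀ (by linarith)
          linarith
        · positivity
        · positivity
    _ = 16 * (2 * n) ^ 19 := by ring

/-- **What the class certifies on a slice.** A submodular measure on `F_n^mon` certifies a
monotone-KW-depth lower bound `d` for `h` only through `2 ^ d ≤ μ h` (Theorem B); on a proper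
slice this forces `d ≤ 19 ⌊log₂ n⌋ + 41 = O(log n)`. -/
theorem certifiedDepth_le (hμ : IsMonotoneSubmodularMeasure μ) {k : ℕ} (hk : 1 ≤ k)
    (hkn : k + 1 ≤ n) {f : (Fin n → Bool) → Bool} (hf : IsSliceFunction k f) {d : ℕ}
    (hd : (2 : ℝ) ^ d ≤ μ f) : d ≤ 19 * Nat.log 2 n + 41 := by
  have hn : 1 ≤ n := by omega
  have h := hμ.sliceCap' hk hkn hf
  -- `2n < 2 ^ (⌊log₂ n⌋ + 2)`, so `16 (2n)^19 < 2 ^ (4 + 19 (⌊log₂ n⌋ + 2))`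
  have hlt : 2 * n < 2 ^ (Nat.log 2 n + 2) := by
    have := Nat.lt_pow_succ_log_self (by norm_num : 1 < 2) n
    rw [pow_succ]; omega
  have hlt' : (2 * n : ℝ) < 2 ^ (Nat.log 2 n + 2) := by exact_mod_cast hlt
  have hpow : (16 : ℝ) * (2 * n) ^ 19 < 2 ^ (4 + (Nat.log 2 n + 2) * 19) := by
    have h19 : ((2 * n : ℝ)) ^ 19 < (2 ^ (Nat.log 2 n + 2)) ^ 19 :=
      pow_lt_pow_left₀ hlt' (by positivity) (by norm_num)
    calc (16 : ℝ) * (2 * n) ^ 19 < 16 * (2 ^ (Nat.log 2 n + 2)) ^ 19 := by linarith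
      _ = 2 ^ (4 + (Nat.log 2 n + 2) * 19) := by
          symm
          rw [pow_add, pow_mul]
          norm_num
  have hfin : (2 : ℝ) ^ d < 2 ^ (4 + (Nat.log 2 n + 2) * 19) := lt_of_le_of_lt (hd.trans h) hpow
  have := (pow_lt_pow_iff_right₀ (by norm_num : (1 : ℝ) < 2)).1 hfin
  omega

end IsMonotoneSubmodularMeasure


/-! ### § Rank — Razborov's rank measures ARE submodular measures on `F_n^mon` (1992, Thm. 1)

Razborov [cite: Razborov1990] [cite: Razborov1992, §2 and Thm. 1 (pp. 79–80)]: fix disjoint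
`U, V ⊆ {0,1}ⁿ`, a field `𝕜` and a matrix `A` over `U × V`.  For `f ∈ F_n` put
`R_f := (U ∩ f⁻¹(0)) × (V ∩ f⁻¹(1))` and `μ_A(f) := rk(A_{R_f}) / max_i rk(A_{R_{0i}})`, where
`R_{0i} = (U ∩ {uᵢ = 0}) × (V ∩ {vᵢ = 1}) = R_{xᵢ}` are the canonical MONOTONE rectangles.  Theorem 1
(monotone case): `μ_A` is a submodular measure on `F_n^mon` — in fact `f ↦ rk(A_{R_f})` is
submodular on ALL pairs (matroid rank), and `μ_A(xᵢ) ≤ 1` by the choice of denominator; only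
`μ_A(¬xᵢ) ≤ 1` fails.  Kernel-checked below (`isMonotoneSubmodularMeasure_rankMeasure`), with
the rank of the rectangle submatrix rendered as the dimension of the span of its (zero-extended)
columns (`rectRank`; = `Matrix.rank` of the submatrix, `rectRank_eq_rank`).  COROLLARY
(`rank_rectangle_le_of_isSliceFunction`): for a `k`-slice function `f` (`1 ≤ k ≤ n-1`), ANY
`U ⊆ f⁻¹(0)`, `V ⊆ f⁻¹(1)`, any field and any matrix `A` on `U × V`,
`rk(A) ≤ 16 (2n)^19 · max(1, max_i rk(A_{R_{0i}}))` — the rank method (and everything that is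
proved by lower-bounding `μ_A`, e.g. rank lifting) yields at most `O(log n)` monotone depth on slices.
-/

section Rank

variable {𝕜 : Type*} [Field 𝕜]
variable (U V : Finset (Fin n → Bool)) (A : (Fin n → Bool) → (Fin n → Bool) → 𝕜)

/-- Column `v` of `A`, as a vector on the cube supported in the row set `U`. -/
def colVec (v : Fin n → Bool) : (Fin n → Bool) → 𝕜 := fun u => if u ∈ U then A u v else 0

/-- The coordinate projection killing the coordinates `u` with `f u = 1` (keeping `f u = 0`). -/
def rowProj (f : (Fin n → Bool) → Bool) : ((Fin n → Bool) → 𝕜) →ₗ[𝕜] ((Fin n → Bool) → 𝕜) where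
  toFun x := fun u => if f u = true then 0 else x u
  map_add' x y := by
    funext u
    simp only [Pi.add_apply]
    split_ifs <;> simp
  map_smul' c x := by
    funext u
    simp only [Pi.smul_apply, smul_eq_mul, RingHom.id_apply]
    split_ifs <;> simp

theorem rowProj_apply (f : (Fin n → Bool) → Bool) (x : (Fin n → Bool) → 𝕜) (u : Fin n → Bool) :
    rowProj (𝕜 := 𝕜) f x u = if f u = true then 0 else x u := rfl

/-- The zero-extended columns of the rectangle submatrix `A[U ∩ f⁻¹(0), V ∩ f⁻¹(1)] = A_{R_f}`. -/
def rectCols (f : (Fin n → Bool) → Bool) : Set ((Fin n → Bool) → 𝕜) :=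
  (fun v => rowProj f (colVec U A v)) '' {v | v ∈ V ∧ f v = true}

/-- `rk(A_{R_f})`: the rank of the submatrix of `A` on Razborov's rectangle
`R_f = (U ∩ f⁻¹(0)) × (V ∩ f⁻¹(1))`, as the dimension of the span of its columns.
[cite: Razborov1992, §2 (p. 80, definition of `R_f` and `μ`)] -/
noncomputable def rectRank (f : (Fin n → Bool) → Bool) : ℕ :=
  Module.finrank 𝕜 (Submodule.span 𝕜 (rectCols U V A f))

/-- Razborov's matroid: the unit vectors `e_u` (`u ∈ U`, `f u = 1`) and the columns `A_v`
(`v ∈ V`, `f v = 1`) in `𝕜^U`. [cite: Razborov1992, proof of Thm. 1 (p. 80)] -/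
def gens (f : (Fin n → Bool) → Bool) : Set ((Fin n → Bool) → 𝕜) :=
  ((fun u => (Pi.single u (1 : 𝕜) : (Fin n → Bool) → 𝕜)) '' {u | u ∈ U ∧ f u = true}) ∪
    (colVec U A '' {v | v ∈ V ∧ f v = true})

/-- `ρ((U ∪ V) ∩ f⁻¹(1))`, the rank function of Razborov's linear matroid. -/
noncomputable def rho (f : (Fin n → Bool) → Bool) : ℕ :=
  Module.finrank 𝕜 (Submodule.span 𝕜 (gens U V A f))

theorem gens_sup (f g : (Fin n → Bool) → Bool) :
    gens U V A (f ⊔ g) = gens U V A f ∪ gens U V A g := by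
  ext x
  simp only [gens, Set.mem_union, Set.mem_image, Set.mem_setOf_eq, sup_apply_eq, Bool.or_eq_true]
  constructor
  · rintro (⟨u, ⟨hu, hf | hg⟩, rfl⟩ | ⟨v, ⟨hv, hf | hg⟩, rfl⟩)
    · exact Or.inl (Or.inl ⟨u, ⟨hu, hf⟩, rfl⟩)
    · exact Or.inr (Or.inl ⟨u, ⟨hu, hg⟩, rfl⟩)
    · exact Or.inl (Or.inr ⟨v, ⟨hv, hf⟩, rfl⟩)
    · exact Or.inr (Or.inr ⟨v, ⟨hv, hg⟩, rfl⟩)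
  · rintro ((⟨u, ⟨hu, hf⟩, rfl⟩ | ⟨v, ⟨hv, hf⟩, rfl⟩) | (⟨u, ⟨hu, hg⟩, rfl⟩ | ⟨v, ⟨hv, hg⟩, rfl⟩))
    · exact Or.inl ⟨u, ⟨hu, Or.inl hf⟩, rfl⟩
    · exact Or.inr ⟨v, ⟨hv, Or.inl hf⟩, rfl⟩
    · exact Or.inl ⟨u, ⟨hu, Or.inr hg⟩, rfl⟩
    · exact Or.inr ⟨v, ⟨hv, Or.inr hg⟩, rfl⟩

theorem gens_inf_subset_left (f g : (Fin n → Bool) → Bool) :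
    gens U V A (f ⊓ g) ⊆ gens U V A f := by
  rintro x (⟨u, ⟨hu, h⟩, rfl⟩ | ⟨v, ⟨hv, h⟩, rfl⟩)
  · rw [inf_apply_eq, Bool.and_eq_true] at h
    exact Or.inl ⟨u, ⟨hu, h.1⟩, rfl⟩
  · rw [inf_apply_eq, Bool.and_eq_true] at h
    exact Or.inr ⟨v, ⟨hv, h.1⟩, rfl⟩

theorem gens_inf_subset_right (f g : (Fin n → Bool) → Bool) :
    gens U V A (f ⊓ g) ⊆ gens U V A g := by
  rintro x (⟨u, ⟨hu, h⟩, rfl⟩ | ⟨v, ⟨hv, h⟩, rfl⟩)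
  · rw [inf_apply_eq, Bool.and_eq_true] at h
    exact Or.inl ⟨u, ⟨hu, h.2⟩, rfl⟩
  · rw [inf_apply_eq, Bool.and_eq_true] at h
    exact Or.inr ⟨v, ⟨hv, h.2⟩, rfl⟩

/-- The matroid rank function is submodular. [cite: Razborov1992, proof of Thm. 1 (p. 80)] -/
theorem rho_submodular (f g : (Fin n → Bool) → Bool) :
    rho U V A (f ⊓ g) + rho U V A (f ⊔ g) ≤ rho U V A f + rho U V A g := by
  unfold rho
  set sf := Submodule.span 𝕜 (gens U V A f)
  set sg := Submodule.span 𝕜 (gens U V A g)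
  have hsup : Submodule.span 𝕜 (gens U V A (f ⊔ g)) = sf ⊔ sg := by
    rw [gens_sup, Submodule.span_union]
  have hinf : Submodule.span 𝕜 (gens U V A (f ⊓ g)) ≤ sf ⊓ sg :=
    le_inf (Submodule.span_mono (gens_inf_subset_left U V A f g))
      (Submodule.span_mono (gens_inf_subset_right U V A f g))
  have h1 := Submodule.finrank_mono hinf
  have h2 := Submodule.finrank_sup_add_finrank_inf_eq sf sg
  rw [hsup]
  omega

/-- The projection kills the unit vectors of `U ∩ f⁻¹(1)`. -/
theorem rowProj_single {f : (Fin n → Bool) → Bool} {u : Fin n → Bool} (hu : f u = true) :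
    rowProj (𝕜 := 𝕜) f (Pi.single u 1) = 0 := by
  funext w
  rw [rowProj_apply, Pi.zero_apply]
  by_cases hw : f w = true
  · rw [if_pos hw]
  · rw [if_neg hw]
    have : w ≠ u := fun h => hw (h ▸ hu)
    simp [this]

/-- Vectors in the span of the generators are supported in `U`. -/
theorem apply_eq_zero_of_mem_span {f : (Fin n → Bool) → Bool} {x : (Fin n → Bool) → 𝕜}
    (hx : x ∈ Submodule.span 𝕜 (gens U V A f)) {w : Fin n → Bool} (hw : w ∉ U) : x w = 0 := by
  -- `gens f ⊆ ker (rowProj [· ∈ U])`, the vectors vanishing off `U`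
  have hle : Submodule.span 𝕜 (gens U V A f) ≤
      LinearMap.ker (rowProj (𝕜 := 𝕜) (fun w => decide (w ∈ U))) := by
    rw [Submodule.span_le]
    rintro y (⟨u, ⟨hu, -⟩, rfl⟩ | ⟨v, ⟨-, -⟩, rfl⟩)
    · rw [SetLike.mem_coe, LinearMap.mem_ker]
      funext w
      rw [rowProj_apply, Pi.zero_apply]
      by_cases hwU : w ∈ U
      · simp [hwU]
      · have : w ≠ u := fun h => hwU (h ▸ hu)
        simp [hwU, this]
    · rw [SetLike.mem_coe, LinearMap.mem_ker]
      funext w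
      rw [rowProj_apply, Pi.zero_apply]
      by_cases hwU : w ∈ U <;> simp [hwU, colVec]
  have := hle hx
  rw [LinearMap.mem_ker] at this
  have hw' := congrFun this w
  rw [rowProj_apply, Pi.zero_apply] at hw'
  simpa [hw] using hw'

/-- **Razborov's identity** `ρ((U ∪ V) ∩ f⁻¹(1)) = rk(A_{R_f}) + |U ∩ f⁻¹(1)|`.
[cite: Razborov1992, proof of Thm. 1 (p. 80, displayed identity)] -/
theorem rho_eq (f : (Fin n → Bool) → Bool) :
    rho U V A f = rectRank U V A f + (U.filter fun u => f u = true).card := by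
  classical
  set W := Submodule.span 𝕜 (gens U V A f) with hW
  set π := rowProj (𝕜 := 𝕜) f with hπ
  have key := LinearMap.finrank_range_add_finrank_ker (π.domRestrict W)
  -- the range is the column span of the rectangle submatrix
  have hrange : LinearMap.range (π.domRestrict W) = Submodule.span 𝕜 (rectCols U V A f) := by
    rw [LinearMap.range_domRestrict, hW, Submodule.map_span, gens, Set.image_union, Set.image_image,
      Set.image_image, Submodule.span_union]
    have hzero : Submodule.span 𝕜 ((fun u => π (Pi.single u (1 : 𝕜))) '' {u | u ∈ U ∧ f u = true})
        = ⊥ := by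
      rw [Submodule.span_eq_bot]
      rintro x ⟨u, ⟨-, hu⟩, rfl⟩
      exact rowProj_single hu
    rw [hzero, bot_sup_eq]
    rfl
  -- the kernel is the span of the unit vectors of `U ∩ f⁻¹(1)`
  set E₁ : Set ((Fin n → Bool) → 𝕜) :=
    Set.range fun u : ↥(U.filter fun u => f u = true) => Pi.single (u : Fin n → Bool) (1 : 𝕜)
    with hE₁
  have hE₁W : Submodule.span 𝕜 E₁ ≤ W := by
    apply Submodule.span_mono
    rintro x ⟨⟨u, hu⟩, rfl⟩
    rw [Finset.mem_filter] at hu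
    exact Or.inl ⟨u, hu, rfl⟩
  have hker : Submodule.map W.subtype (LinearMap.ker (π.domRestrict W)) = Submodule.span 𝕜 E₁ := by
    rw [LinearMap.ker_domRestrict, Submodule.map_comap_subtype]
    apply le_antisymm
    · rintro x ⟨hxW, hxk⟩
      rw [SetLike.mem_coe, LinearMap.mem_ker] at hxk
      -- `x` is supported in `U ∩ f⁻¹(1)`, hence a combination of its unit vectors
      have hsupp : ∀ w, w ∉ U.filter (fun u => f u = true) → x w = 0 := by
        intro w hw
        rw [Finset.mem_filter, not_and] at hw
        by_cases hwU : w ∈ U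
        · have hfw : f w = false := by simpa using hw hwU
          have := congrFun hxk w
          rw [rowProj_apply, Pi.zero_apply, hfw] at this
          simpa using this
        · exact apply_eq_zero_of_mem_span U V A hxW hwU
      have hx : x = ∑ u ∈ U.filter (fun u => f u = true), x u • (Pi.single u (1 : 𝕜)) := by
        funext w
        rw [Finset.sum_apply]
        simp only [Pi.smul_apply, Pi.single_apply, smul_eq_mul, mul_ite, mul_one, mul_zero]
        rw [Finset.sum_ite_eq]
        split_ifs with h
        · rfl
        · exact hsupp w h
      rw [hx]
      refine Submodule.sum_mem _ fun u hu => Submodule.smul_mem _ _ (Submodule.subset_span ?_)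
      exact ⟨⟨u, hu⟩, rfl⟩
    · refine le_inf hE₁W ?_
      rw [Submodule.span_le]
      rintro x ⟨⟨u, hu⟩, rfl⟩
      rw [Finset.mem_filter] at hu
      rw [SetLike.mem_coe, LinearMap.mem_ker]
      exact rowProj_single hu.2
  have hkerrank : Module.finrank 𝕜 (LinearMap.ker (π.domRestrict W)) =
      (U.filter fun u => f u = true).card := by
    rw [← Submodule.finrank_map_subtype_eq, hker, hE₁, finrank_span_eq_card, Fintype.card_coe]
    exact (Pi.linearIndependent_single_one (Fin n → Bool) 𝕜).comp _ Subtype.val_injective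
  unfold rho rectRank
  rw [← hW, ← key, hrange, hkerrank]

/-- **`f ↦ rk(A_{R_f})` is submodular on all of `F_n`.** [cite: Razborov1992, Thm. 1a (p. 80)] -/
theorem rectRank_submodular (f g : (Fin n → Bool) → Bool) :
    rectRank U V A (f ⊓ g) + rectRank U V A (f ⊔ g) ≤ rectRank U V A f + rectRank U V A g := by
  have h := rho_submodular U V A f g
  rw [rho_eq, rho_eq, rho_eq, rho_eq] at h
  have hcard : (U.filter fun u => (f ⊓ g) u = true).card + (U.filter fun u => (f ⊔ g) u = true).card
      = (U.filter fun u => f u = true).card + (U.filter fun u => g u = true).card := by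
    have hi : (U.filter fun u => (f ⊓ g) u = true) =
        (U.filter fun u => f u = true) ∩ (U.filter fun u => g u = true) := by
      ext u; simp [Finset.mem_filter, Bool.and_eq_true, and_assoc, and_left_comm]
    have hu : (U.filter fun u => (f ⊔ g) u = true) =
        (U.filter fun u => f u = true) ∪ (U.filter fun u => g u = true) := by
      ext u; simp [Finset.mem_filter, Bool.or_eq_true, and_or_left]
    rw [hi, hu, add_comm, Finset.card_union_add_card_inter]
  omega

/-- **Razborov's rank measure** (monotone case): `μ_A(f) = rk(A_{R_f}) / max_i rk(A_{R_{0i}})`,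
`R_{0i} = R_{xᵢ}`; the denominator is taken `≥ 1` so that the degenerate `A` with all canonical
ranks `0` also yields a measure. [cite: Razborov1992, §2 (p. 80)] [cite: Razborov1990] -/
noncomputable def rankMeasure (f : (Fin n → Bool) → Bool) : ℝ :=
  rectRank U V A f / max 1 (Finset.univ.sup fun i : Fin n => rectRank U V A (proj i) : ℕ)

/-- **Razborov 1992, Theorem 1 (monotone case), kernel-checked**: the rank measure is a submodular
complexity measure on `F_n^mon` (indeed submodular on all pairs and normalised on positive literals).
[cite: Razborov1992, Thm. 1 and the remark "Similar results hold for the monotone case" (p. 80)] -/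
theorem isMonotoneSubmodularMeasure_rankMeasure : IsMonotoneSubmodularMeasure (rankMeasure U V A) := by
  set D : ℕ := max 1 (Finset.univ.sup fun i : Fin n => rectRank U V A (proj i)) with hD
  have hDpos : (0 : ℝ) < (D : ℝ) := by exact_mod_cast (show 0 < D by omega)
  refine ⟨fun f _ => div_nonneg (Nat.cast_nonneg _) hDpos.le, fun i => ?_, fun f g _ _ => ?_⟩
  · unfold rankMeasure
    rw [div_le_one hDpos]
    have : rectRank U V A (proj i) ≤ D :=
      (Finset.le_sup (f := fun i : Fin n => rectRank U V A (proj i)) (Finset.mem_univ i)).trans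
        (le_max_right _ _)
    exact_mod_cast this
  · unfold rankMeasure
    rw [← add_div, ← add_div]
    refine div_le_div_of_nonneg_right ?_ hDpos.le
    exact_mod_cast rectRank_submodular U V A f g

/-- COROLLARY: the rank measure is polynomially capped on the proper slices. -/
theorem rankMeasure_le_of_isSliceFunction {k : ℕ} (hk : 1 ≤ k) (hkn : k + 1 ≤ n)
    {f : (Fin n → Bool) → Bool} (hf : IsSliceFunction k f) :
    rankMeasure U V A f ≤ 16 * (2 * n) ^ 19 :=
  (isMonotoneSubmodularMeasure_rankMeasure U V A).sliceCap' hk hkn hf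

/-- **The rank method on slices.** For a `k`-slice function `f` (`1 ≤ k ≤ n-1`), row set
`U ⊆ f⁻¹(0)`, column set `V ⊆ f⁻¹(1)`, any field and any matrix `A` on `U × V`:
`rk(A) ≤ 16 (2n)^19 · max(1, max_i rk(A_{R_{0i}}))` — Razborov's bound (5) [cite: Razborov1990]
[cite: Razborov1992, Prop. 1 / Thm. 1b] certifies at most polynomial monotone formula size,
i.e. `O(log n)` monotone depth, on slice functions. -/
theorem rank_rectangle_le_of_isSliceFunction {k : ℕ} (hk : 1 ≤ k) (hkn : k + 1 ≤ n)
    {f : (Fin n → Bool) → Bool} (hf : IsSliceFunction k f) :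
    (rectRank U V A f : ℝ) ≤
      16 * (2 * n) ^ 19 * (max 1 (Finset.univ.sup fun i : Fin n => rectRank U V A (proj i)) : ℕ) := by
  have h := rankMeasure_le_of_isSliceFunction U V A hk hkn hf
  unfold rankMeasure at h
  have hDpos : (0 : ℝ) <
      ((max 1 (Finset.univ.sup fun i : Fin n => rectRank U V A (proj i)) : ℕ) : ℝ) := by
    exact_mod_cast (show 0 < max 1 (Finset.univ.sup fun i : Fin n => rectRank U V A (proj i))
      by omega)
  rwa [div_le_iff₀ hDpos] at h

/-- `rectRank` is the rank of the rectangle submatrix in Mathlib's sense (`Matrix.rank` = dimension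
of the column span): the zero-extension `𝕜^{U₀} ↪ 𝕜^{{0,1}ⁿ}` is an injective linear map carrying
the columns of the submatrix onto `rectCols`. -/
theorem rectRank_eq_rank (f : (Fin n → Bool) → Bool) :
    rectRank U V A f =
      (Matrix.of fun (u : ↥(U.filter fun u => f u = false)) (v : ↥(V.filter fun v => f v = true)) =>
        A u v).rank := by
  classical
  set U₀ := U.filter fun u => f u = false with hU₀
  set V₁ := V.filter fun v => f v = true with hV₁
  set M : Matrix ↥U₀ ↥V₁ 𝕜 := Matrix.of fun u v => A u v with hM
  -- zero-extension from `U₀` to the whole cube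
  let ext0 : (↥U₀ → 𝕜) →ₗ[𝕜] ((Fin n → Bool) → 𝕜) :=
    { toFun := fun x w => if h : w ∈ U₀ then x ⟨w, h⟩ else 0
      map_add' := fun x y => by funext w; by_cases h : w ∈ U₀ <;> simp [h]
      map_smul' := fun c x => by funext w; by_cases h : w ∈ U₀ <;> simp [h] }
  have hinj : Function.Injective ext0 := by
    intro x y hxy
    funext ⟨w, hw⟩
    have := congrFun hxy w
    simpa [ext0, hw] using this
  have himg : ext0 '' Set.range M.col = rectCols U V A f := by
    ext x
    simp only [Set.mem_image, Set.mem_range, rectCols, Set.mem_setOf_eq]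
    constructor
    · rintro ⟨y, ⟨⟨v, hv⟩, rfl⟩, rfl⟩
      refine ⟨v, by simpa [hV₁, Finset.mem_filter] using hv, ?_⟩
      funext w
      simp only [ext0, LinearMap.coe_mk, AddHom.coe_mk, rowProj_apply, colVec, Matrix.col_apply,
        hM, Matrix.of_apply]
      by_cases hw : w ∈ U₀
      · have hw' := hw; rw [hU₀, Finset.mem_filter] at hw'
        simp [hw, hw'.1, hw'.2]
      · have hw' := hw; rw [hU₀, Finset.mem_filter, not_and] at hw'
        by_cases hwU : w ∈ U
        · have : f w = true := by simpa using hw' hwU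
          simp [hw, this]
        · simp [hw, hwU]
    · rintro ⟨v, hv, rfl⟩
      refine ⟨M.col ⟨v, by simpa [hV₁, Finset.mem_filter] using hv⟩, ⟨_, rfl⟩, ?_⟩
      funext w
      simp only [ext0, LinearMap.coe_mk, AddHom.coe_mk, rowProj_apply, colVec, Matrix.col_apply,
        hM, Matrix.of_apply]
      by_cases hw : w ∈ U₀
      · have hw' := hw; rw [hU₀, Finset.mem_filter] at hw'
        simp [hw, hw'.1, hw'.2]
      · have hw' := hw; rw [hU₀, Finset.mem_filter, not_and] at hw'
        by_cases hwU : w ∈ U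
        · have : f w = true := by simpa using hw' hwU
          simp [hw, this]
        · simp [hw, hwU]
  rw [Matrix.rank_eq_finrank_span_cols, rectRank, ← himg, ← Submodule.map_span]
  exact ((Submodule.equivMapOfInjective ext0 hinj _).finrank_eq).symm

end Rank


/-! ### § Layer — the cap governs the LAYERED monotone games of FILE D

FILE D (`LayeredKRW.lean`) asks for lower bounds on protocols solving the monotone KW game of `f` only
ON A HAMMING LAYER `{|a| = l}` (`LayeredKRW.SolvesLayeredMono`, restated verbatim below; doors
`LayeredMonotoneKRWFrac`, …).
What a submodular measure `μ` on `F_n^mon` certifies for such a protocol `Q` is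
`leafCount Q ≥ μ h` for SOME monotone `h` agreeing with `f` on the layer
(`exists_separator_of_solvesLayeredMono` = Theorem B on the layer rectangle), i.e. at best
`inf {μ h : h ∈ F_n^mon, h = f on the layer}` — and that infimum is `≤ μ (slicify l f) ≤ 16 (2n)^19`
for EVERY `f` (monotone or not) and every proper layer `1 ≤ l ≤ n-1` (`layered_certificate_le`),
because `slicify l f` is a monotone `l`-slice function agreeing with `f` on the layer.  On the layered
doors the whole submodular class (rank measures included, § Rank) certifies `O(log n)` depth.
-/

section Layer

variable {μ : ((Fin n → Bool) → Bool) → ℝ}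

/-- VERBATIM `LayeredKRW.SolvesLayeredMono` (FILE D, `Cruxes/StrongComposition/LayeredKRW.lean`),
restated so that this file does not depend on FILE D's build (the two agree by `Iff.rfl` when both are
in scope): `Q` solves the MONOTONE KW game of `f` ON LAYER `l` — on every pair of weight-`l` inputs
`a ∈ f⁻¹(1)`, `b ∈ f⁻¹(0)` the output coordinate `i` has `a i = 1`, `b i = 0`. -/
def SolvesLayeredMono (Q : KWTree (Fin n)) (f : (Fin n → Bool) → Bool) (l : ℕ) : Prop :=
  ∀ a b : Fin n → Bool, hammingWeight a = l → hammingWeight b = l → f a = true → f b = false →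
    a (Q.run a b) = true ∧ b (Q.run a b) = false

/-- `slicify l f` agrees with `f` on the layer `{|x| = l}`. -/
theorem slicify_apply_of_hammingWeight_eq (l : ℕ) (f : (Fin n → Bool) → Bool) {x : Fin n → Bool}
    (hx : hammingWeight x = l) : slicify l f x = f x := by
  rw [slicify_apply, (thresholdFn_eq_true_iff x).2 hx.ge,
    (thresholdFn_eq_false_iff x).2 (by omega : hammingWeight x < l + 1)]
  cases f x <;> rfl

/-- What a submodular measure on `F_n^mon` CERTIFIES for FILE D's layered monotone game
(`SolvesLayeredMono Q f l`: correctness only on pairs of weight-`l` inputs): `#leaves(Q) ≥ μ h`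
for SOME monotone `h` agreeing with `f` on the layer (Theorem B run on the layer rectangle).
[cite: KarchmerWigderson1990, §2 (easy direction)] [cite: Razborov1992, §1] -/
theorem exists_separator_of_solvesLayeredMono (hμ : IsMonotoneSubmodularMeasure μ) {l : ℕ}
    {f : (Fin n → Bool) → Bool} (Q : KWTree (Fin n)) (hQ : SolvesLayeredMono Q f l)
    (h1 : ∃ a : Fin n → Bool, hammingWeight a = l ∧ f a = true)
    (h0 : ∃ b : Fin n → Bool, hammingWeight b = l ∧ f b = false) :
    ∃ h : (Fin n → Bool) → Bool, Monotone h ∧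
      (∀ x, hammingWeight x = l → h x = f x) ∧ μ h ≤ Q.leafCount := by
  obtain ⟨φ, hφm, hT, hF, hle⟩ := hμ.exists_separator_of_rectangle Q
    {a | hammingWeight a = l ∧ f a = true} {b | hammingWeight b = l ∧ f b = false} h1 h0
    (fun a ha b hb => by
      rw [Set.mem_setOf_eq] at ha hb
      exact hQ a b ha.1 hb.1 ha.2 hb.2)
  refine ⟨φ, hφm, fun x hx => ?_, hle⟩
  have hTx := hT x
  have hFx := hF x
  rw [Set.mem_setOf_eq] at hTx hFx
  cases hfx : f x
  · exact hFx ⟨hx, hfx⟩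
  · exact hTx ⟨hx, hfx⟩

/-- … and that certificate is polynomially capped: for EVERY `f` and every proper layer `1 ≤ l ≤ n-1`
there is a monotone `l`-slice function agreeing with `f` on the layer — `slicify l f` — of measure
`≤ 16 (2n)^19`.  So `inf {μ h : h monotone, h = f on layer l}`, the best lower bound `μ` can certify
for the layered game, is `≤ 16 (2n)^19`: `O(log n)` depth. -/
theorem layered_certificate_le (hμ : IsMonotoneSubmodularMeasure μ) {l : ℕ} (hl : 1 ≤ l)
    (hln : l + 1 ≤ n) (f : (Fin n → Bool) → Bool) :
    ∃ h : (Fin n → Bool) → Bool, Monotone h ∧ IsSliceFunction l h ∧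
      (∀ x, hammingWeight x = l → h x = f x) ∧ μ h ≤ 16 * (2 * n) ^ 19 :=
  ⟨slicify l f, monotone_slicify l f, isSliceFunction_slicify l f,
    fun _ hx => slicify_apply_of_hammingWeight_eq l f hx,
    hμ.sliceCap' hl hln (isSliceFunction_slicify l f)⟩

/-- The two halves together, in depth form: if a submodular measure on `F_n^mon` gives `μ h ≥ 2^d`
for EVERY monotone `h` agreeing with `f` on a proper layer (the only way it can force layered depth
`≥ d` through `exists_separator_of_solvesLayeredMono`), then `d ≤ 19 ⌊log₂ n⌋ + 41`. -/
theorem layered_certifiedDepth_le (hμ : IsMonotoneSubmodularMeasure μ) {l : ℕ} (hl : 1 ≤ l)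
    (hln : l + 1 ≤ n) (f : (Fin n → Bool) → Bool) {d : ℕ}
    (hd : ∀ h : (Fin n → Bool) → Bool, Monotone h → (∀ x, hammingWeight x = l → h x = f x) →
      (2 : ℝ) ^ d ≤ μ h) :
    d ≤ 19 * Nat.log 2 n + 41 :=
  hμ.certifiedDepth_le hl hln (isSliceFunction_slicify l f)
    (hd _ (monotone_slicify l f) fun _ hx => slicify_apply_of_hammingWeight_eq l f hx)

end Layer

/-! ### Sharpness of the hypotheses: the edge slices are genuinely excluded -/

/-- On `F_n^mon` the constants are unconstrained: for every `C` there is a submodular measure on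
`F_n^mon` with `μ ⊤ = C` (so the `0`-slice function `⊤` has no cap; dually for `⊥` and `k = n`).
Witness: `μ f = C · [f = ⊤]` — submodular on monotone pairs because `f ∨ g = ⊤` with `f, g`
monotone forces `f = ⊤` or `g = ⊤`. -/
theorem exists_measure_top_large (C : ℝ) (hC : 0 ≤ C) :
    ∃ μ : ((Fin n → Bool) → Bool) → ℝ,
      IsMonotoneSubmodularMeasure μ ∧ μ ⊤ = C := by
  classical
  refine ⟨fun f => if f = ⊤ then C else 0, ⟨fun f _ => ?_, fun i => ?_, fun f g hf hg => ?_⟩,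
    by simp⟩
  · dsimp only
    split_ifs <;> simp [hC]
  · have hne : (proj i : (Fin n → Bool) → Bool) ≠ ⊤ := fun h =>
      Bool.false_ne_true (congrFun h (fun _ => false))
    simp [hne]
  · -- case analysis on whether `f ⊔ g = ⊤`
    dsimp only
    by_cases hsup : f ⊔ g = ⊤
    · -- then `f ⊥ ∨ g ⊥ = true`, so one of them is `⊤` by monotonicity
      have hbot : (f ⊔ g) (fun _ => false) = true := by rw [hsup]; rfl
      rw [sup_apply_eq, Bool.or_eq_true] at hbot
      have key : ∀ h : (Fin n → Bool) → Bool, Monotone h → h (fun _ => false) = true → h = ⊤ := by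
        intro h hh h0
        funext x
        exact (monotone_iff_forall_true h).1 hh _ x (fun i => by simp) h0
      rcases hbot with h0 | h0
      · have hf' := key f hf h0
        subst hf'
        have : (⊤ : (Fin n → Bool) → Bool) ⊓ g = g := top_inf_eq g
        rw [this, hsup]; simp only [if_true]; linarith
      · have hg' := key g hg h0
        subst hg'
        have : f ⊓ (⊤ : (Fin n → Bool) → Bool) = f := inf_top_eq f
        rw [this, hsup]
    · have hinf : f ⊓ g ≠ ⊤ := by
        intro h
        apply hsup
        exact top_le_iff.1 (le_trans (le_of_eq h.symm) (inf_le_left.trans le_sup_left))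
      simp only [hsup, hinf, if_false, add_zero]
      split_ifs <;> linarith

/-! ### Sanity: the class is inhabited and contains the standard submodular measures -/

/-- The density measure (in tree) is a submodular measure on `F_n^mon`. -/
example : IsMonotoneSubmodularMeasure (Literature.Barriers.PneNP.densityMeasure (n := n)) :=
  IsMonotoneSubmodularMeasure.of_isSubmodularMeasure
    Literature.Barriers.PneNP.isSubmodularMeasure_density

/-- Nominal link to the crux this workfile calibrates (no mathematical dependence). -/
example : Prop := Summit.PneNP.PneNP.Theses.KrwChromaticSteering.StrongComposition


end Summit.PneNP.PneNP.Cruxes.StrongComposition.SubmodularSliceCap
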